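import Summits.BirchSwinnertonDyer.BirchSwinnertonDyer.Theorems.AlignedTransportAtTwoMainConjectureOfRankZeroBSDAtTwoHalfDescentLayerIndexGrowthFiniteComplete
import Summits.BirchSwinnertonDyer.BirchSwinnertonDyer.Theorems.ByReductionTypeAtTwoGoodOrdTowerControl
import Literature.NumberTheory.EllipticCurves.IwasawaTowerTorsionFiniteProofs
import Literature.NumberTheory.EllipticCurves.IwasawaSelmerControlKernelCardProofs
import Literature.NumberTheory.EllipticCurves.IwasawaSelmerModuleFiniteProofs
import Literature.NumberTheory.EllipticCurves.SelmerCorankControlRatProofs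
import HarnessLib

/-!
# Route `AlignedTransportAtTwo`, crux C2 `MainConjectureOfRankZeroBSDAtTwo` (stmt-BirchSwinnertonDyer-22298):
# THE GROWTH NUMBER AT FINITE LEVEL, V — UNCONDITIONAL COMPLETENESS ON THE `p = 2` CELL: for `W/ℚ` good ordinary at `2`, the cyclotomic `ℤ₂`-tower and `X` torsion,
# `μ(X(W/ℚ_∞)) = 0 ⟺ ∃ n, 0 < #((γ^{2ⁿ} − 1)·Sel_{2^∞}(W/ℚ_{n+1})) · #ker g_{n+1} < 2^{2ⁿ}` — road (a)'s stub T per datum IS the existence of one certifying layer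

HONEST FRAMING (cell `bsd-f1-sign2`, WIDTH-5 attached prover seat `bsd-line-att-p5` gen 57 on line `birth` of the lead `bsd-line-att-p2`;
`--supports` stmt-BirchSwinnertonDyer-22298, closes nothing; BSD is NOT proved by any of this; the crux C2, its verdict «blocked-on
`Rank1Residual.GreenbergMuConjectureIrreducible`» and every registered stub (P / T / Kμ / LimDoor / MuIneqʳ / PFμ⁺) are untouched). THEOREMS ONLY — no `def`,
no instance, no named fact, no `sorry`. Route-independent (no Theses import). Sequel of `…GrowthFiniteComplete` (the finite-level door is complete under the displayed inputs
«`#ker h_n` finite and bounded», «`#ker g_n` finite and bounded»); here both inputs are DISCHARGED over `ℚ` from tree theorems: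

* §1 ★ `exists_forall_natCard_ker_layerToInfty_pos_le` — for EVERY elliptic `W/ℚ`, every `p`, every `ℤ_p`-extension: **`∃ T, ∀ n, 0 < #ker h_n ≤ T`** (`#ker h_n = #E[p^∞]^{Gal(ℚ̄/ℚ_n)}`,
  tree `natCard_ker_layerToInfty_eq_natCard_fixedPoints`, inside `E(ℚ_∞)[p^∞]`, finite by the tree's `finite_fixedPoints_kerSubgroup_geomPrimaryTorsion_rat`).
* §2 ★ `exists_forall_natCard_kerG_pos_le_two` — `W/ℚ` elliptic, globally minimal, `IsOrdinaryAt W 2`, `κ` the cyclotomic `ℤ₂`-extension: **`∃ C, ∀ n, 0 < #ker g_n ≤ C`** (tree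
  `Greenberg1999_kerG_bounded_two` — Greenberg's Lemma 3.5 at `2`, kernel-proved in the cell `bsd-2adic` — fed by `hasGoodReductionAt_and_hasUnitRootAt_of_rat`).
* §3 ★★★ `mu_eq_zero_iff_exists_natCard_map_selmerLayer_mul_kerG_lt_two` — **`μ(X(W/ℚ_∞)) = 0 ⟺ ∃ n, 0 < #((γ^{2ⁿ} − 1)·Sel_{2^∞}(W/ℚ_{n+1})) · #ker g_{n+1} < 2^{2ⁿ}`** for every `W/ℚ` good
  ordinary at `2`, cyclotomic `(κ, γ)` and torsion datum `D` — NO displayed hypothesis left; ★★★ `seedMu_iff_exists_natCard_map_selmerLayer_mul_kerG_lt_two` — road (a)'s stub T per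
  datum `(D.IsTorsion → D.mu = 0)` ⟺ `(D.IsTorsion → ∃ n, door)`; the gen-44 analogue in descent currency was `T ⟺ ∃ j<k, #Sel^(2)(E/ℚ_k)·#ker g_k·2^{2^j} < #Sel^(2)(E/ℚ_j)·2^{2^k}` — here ONE
  layer and only the image of `g − 1` (⊆ the minus part).
What is NOT claimed: nothing about any curve; no Selmer group computed; C2 untouched. Memo `Cruxes/MainConjectureOfRankZeroBSDAtTwo/GROWTH-FINITE-att-p5-g57.md`.

References: R. Greenberg, LNM 1716 (1999), §1 p. 62, Conj. 1.11, §3 Lemmas 3.1–3.5 (pp. 85–90), §4 Lemma 4.3 [GreenbergLNM1716]; B. Mazur, Invent. Math. 18 (1972) §6, Prop. 6.12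
[Mazur1972]; J. Silverman, AEC, Prop. III.8.1 [SilvermanAEC2009]; L. Washington, GTM 83 §13.3 [Washington1997].
-/

set_option linter.dupNamespace false
set_option autoImplicit false

noncomputable section

open scoped Classical AddSubgroup Polynomial

namespace Summit.BirchSwinnertonDyer.BirchSwinnertonDyer.Theorems.AlignedTransportAtTwoHalfDescentLayerIndexGrowthFiniteCompleteTwo

open WeierstrassCurve Literature.NumberTheory.EllipticCurves Literature.NumberTheory.EllipticCurves.IwasawaDual
  Literature.NumberTheory.EllipticCurves.IwasawaAlgebra
  Summit.BirchSwinnertonDyer.Rank1Residual.X1.MuLambda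
  Summit.BirchSwinnertonDyer.Rank1Residual.Iwasawa
  Summit.BirchSwinnertonDyer.BirchSwinnertonDyer.Theorems.GoodOrdTower
  Summit.BirchSwinnertonDyer.BirchSwinnertonDyer.Theorems.AlignedTransportAtTwoHalfDescentLayerIndexGrowthFinite
  Summit.BirchSwinnertonDyer.BirchSwinnertonDyer.Theorems.AlignedTransportAtTwoHalfDescentLayerIndexGrowthFiniteComplete

/-! ## §1 Over `ℚ` the restriction kernels `ker h_n` are finite, non-empty and bounded (any `p`, any `ℤ_p`-extension) -/

section KerH

variable (W : WeierstrassCurve ℚ) [W.IsElliptic] {p : ℕ} [hp : Fact p.Prime] (κ : ZpExtension ℚ p)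

/-- ★ **`∃ T, ∀ n, 0 < #ker h_n ≤ T`** for every elliptic `W/ℚ`, every prime `p` and every `ℤ_p`-extension of `ℚ`: `#ker h_n = #E[p^∞]^{Gal(ℚ̄/ℚ_n)}` (tree, Lemma 4.3's
substitution) and `E[p^∞]^{Gal(ℚ̄/ℚ_n)} ⊆ E(ℚ_∞)[p^∞]`, which is finite (tree `finite_fixedPoints_kerSubgroup_geomPrimaryTorsion_rat`, Weil pairing + complex conjugation).
[cite: GreenbergLNM1716, §1 p. 62, §3 p. 86, §4 Lemma 4.3] -/
theorem exists_forall_natCard_ker_layerToInfty_pos_le :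
    ∃ T : ℕ, ∀ n, 0 < Nat.card (W.layerToInfty κ n).ker ∧ Nat.card (W.layerToInfty κ n).ker ≤ T := by
  haveI hB := W.finite_fixedPoints_kerSubgroup_geomPrimaryTorsion_rat κ
  refine ⟨Nat.card (FixedPoints.addSubgroup κ.kerSubgroup (geomPrimaryTorsion W p)), fun n ↦ ?_⟩
  rw [W.natCard_ker_layerToInfty_eq_natCard_fixedPoints κ n]
  let f : {m : geomPrimaryTorsion W p | ∀ σ ∈ κ.layerSubgroup n, σ • m = m} → FixedPoints.addSubgroup κ.kerSubgroup (geomPrimaryTorsion W p) :=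
    fun m ↦ ⟨m.1, (FixedPoints.mem_addSubgroup _ _ _).mpr fun τ ↦ by
      rw [Subgroup.mk_smul]
      exact m.2 τ (κ.kerSubgroup_le_layerSubgroup n τ.2)⟩
  have hf : Function.Injective f := fun a b h ↦
    Subtype.ext (congrArg (fun x : ↥(FixedPoints.addSubgroup κ.kerSubgroup (geomPrimaryTorsion W p)) ↦ (x : geomPrimaryTorsion W p)) h)
  haveI : Finite {m : geomPrimaryTorsion W p | ∀ σ ∈ κ.layerSubgroup n, σ • m = m} := Finite.of_injective f hf
  haveI : Nonempty {m : geomPrimaryTorsion W p | ∀ σ ∈ κ.layerSubgroup n, σ • m = m} := ⟨⟨0, fun σ _ ↦ smul_zero σ⟩⟩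
  exact ⟨Nat.card_pos, Nat.card_le_card_of_injective f hf⟩

end KerH

/-! ## §2 `p = 2`: Greenberg's control kernels are finite, non-empty and bounded on the cell (tree, Lemma 3.5 at `2`) -/

section KerG

variable (W : WeierstrassCurve ℚ) [W.IsElliptic] [W.IsGloballyMinimal] (κ : ZpExtension ℚ 2)

/-- ★ **`∃ C, ∀ n, 0 < #ker g_n ≤ C`** for `W/ℚ` elliptic, globally minimal, good ordinary at `2`, and `κ` the cyclotomic `ℤ₂`-extension (tree `Greenberg1999_kerG_bounded_two`:
Greenberg's Lemma 3.5 at `p = 2`, kernel-proved in the cell `bsd-2adic`; `IsOrdinaryAt` ↦ the place-wise hypotheses by `hasGoodReductionAt_and_hasUnitRootAt_of_rat`).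
[cite: GreenbergLNM1716, §3 Lemma 3.5 (p. 90) with Lemmas 3.3–3.4] -/
theorem exists_forall_natCard_kerG_pos_le_two (hord : IsOrdinaryAt W 2) (hκ : κ.IsCyclotomic) :
    ∃ C : ℕ, ∀ n, 0 < Nat.card (W.KerG κ n) ∧ Nat.card (W.KerG κ n) ≤ C := by
  obtain ⟨B, hB⟩ := Greenberg1999_kerG_bounded_two W κ hκ
    (fun v hv ↦ W.hasGoodReductionAt_and_hasUnitRootAt_of_rat hord.1 hord.2 v hv)
  refine ⟨B, fun n ↦ ?_⟩
  haveI := (hB n).1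
  exact ⟨Nat.card_pos, (hB n).2⟩

end KerG

/-! ## §3 `p = 2`: the finite-level door is complete on the cell -/

section Two

variable (W : WeierstrassCurve ℚ) [W.IsElliptic] [W.IsGloballyMinimal] (κ : ZpExtension ℚ 2) {γ : Field.absoluteGaloisGroup ℚ}

/-- ★★★ **`p = 2`, UNCONDITIONAL COMPLETENESS ON THE CELL: `μ(X(W/ℚ_∞)) = 0 ⟺ ∃ n, 0 < #((γ^{2ⁿ} − 1)·Sel_{2^∞}(W/ℚ_{n+1})) · #ker g_{n+1} < 2^{2ⁿ}`** for every
`W/ℚ` elliptic, globally minimal, good ordinary at `2`, the cyclotomic `ℤ₂`-extension `κ` with topological generator `γ`, and every Pontryagin-dual datum `D` with `X` torsion —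
both boundedness inputs of file IV are tree theorems here (§1, §2). Road (a)'s stub T of line `birth` at `(W, κ, γ, D)` is therefore EQUIVALENT to the existence of ONE
layer `ℚ_{n+1} = ℚ(ζ_{2^{n+3}})⁺` at which the image of `γ^{2ⁿ} − 1` on the honest `2^∞`-Selmer group, times Greenberg's control kernel, is smaller than `2^{2ⁿ}`.
[cite: GreenbergLNM1716, Conj. 1.11, §3 Lemmas 3.1–3.5, §4 Lemma 4.3] [cite: Mazur1972, §6] [cite: Washington1997, §13.3 Thm. 13.13] -/
theorem mu_eq_zero_iff_exists_natCard_map_selmerLayer_mul_kerG_lt_two (hord : IsOrdinaryAt W 2) (hκ : κ.IsCyclotomic) (hγ : κ.IsTopGenerator γ)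
    (D : W.SelmerDualData κ γ) (hD : D.IsTorsion) :
    D.mu = 0 ↔ ∃ n : ℕ, 0 < Nat.card ↥((W.selmerLayer κ (n + 1)).map
          (W.conjH1 2 (κ.layerSubgroup (n + 1)) (γ ^ 2 ^ n) - AddMonoidHom.id (W.subgroupH1 2 (κ.layerSubgroup (n + 1))))) *
        Nat.card (W.KerG κ (n + 1)) ∧
      Nat.card ↥((W.selmerLayer κ (n + 1)).map
          (W.conjH1 2 (κ.layerSubgroup (n + 1)) (γ ^ 2 ^ n) - AddMonoidHom.id (W.subgroupH1 2 (κ.layerSubgroup (n + 1))))) *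
        Nat.card (W.KerG κ (n + 1)) < 2 ^ (2 ^ n) := by
  haveI : Module.Finite (IwasawaAlgebra 2) D.X := D.module_finite_holds hγ
  have h := mu_eq_zero_iff_exists_natCard_map_selmerLayer_mul_kerG_lt W κ hγ D hD
    (exists_forall_natCard_ker_layerToInfty_pos_le W κ) (exists_forall_natCard_kerG_pos_le_two W κ hord hκ)
  simp only [show (2 : ℕ) - 1 = 1 from rfl, mul_one] at h
  exact h

/-- ★★★ **ROAD (a)'s STUB T PER DATUM ⟺ THE FINITE-LEVEL DOOR** (`p = 2`, cell hypotheses: elliptic, globally minimal, good ordinary at `2`, cyclotomic `κ`, topological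
generator `γ`): **`(D.IsTorsion → D.mu = 0) ⟺ (D.IsTorsion → ∃ n, 0 < #((γ^{2ⁿ} − 1)·Sel_{2^∞}(W/ℚ_{n+1}))·#ker g_{n+1} < 2^{2ⁿ})`**.
[cite: GreenbergLNM1716, Conj. 1.11, §3 Lemmas 3.1–3.5, §4 Lemma 4.3] -/
theorem seedMu_iff_exists_natCard_map_selmerLayer_mul_kerG_lt_two (hord : IsOrdinaryAt W 2) (hκ : κ.IsCyclotomic) (hγ : κ.IsTopGenerator γ)
    (D : W.SelmerDualData κ γ) :
    (D.IsTorsion → D.mu = 0) ↔ (D.IsTorsion → ∃ n : ℕ, 0 < Nat.card ↥((W.selmerLayer κ (n + 1)).map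
          (W.conjH1 2 (κ.layerSubgroup (n + 1)) (γ ^ 2 ^ n) - AddMonoidHom.id (W.subgroupH1 2 (κ.layerSubgroup (n + 1))))) *
        Nat.card (W.KerG κ (n + 1)) ∧
      Nat.card ↥((W.selmerLayer κ (n + 1)).map
          (W.conjH1 2 (κ.layerSubgroup (n + 1)) (γ ^ 2 ^ n) - AddMonoidHom.id (W.subgroupH1 2 (κ.layerSubgroup (n + 1))))) *
        Nat.card (W.KerG κ (n + 1)) < 2 ^ (2 ^ n)) :=
  ⟨fun h hD ↦ (mu_eq_zero_iff_exists_natCard_map_selmerLayer_mul_kerG_lt_two W κ hord hκ hγ D hD).mp (h hD),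
    fun h hD ↦ (mu_eq_zero_iff_exists_natCard_map_selmerLayer_mul_kerG_lt_two W κ hord hκ hγ D hD).mpr (h hD)⟩

end Two

end Summit.BirchSwinnertonDyer.BirchSwinnertonDyer.Theorems.AlignedTransportAtTwoHalfDescentLayerIndexGrowthFiniteCompleteTwo

end
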